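import Mathlib

/-!
# Tier4/Line4/CentralCover — C-L4-CENTRAL-COVER (F-c)/(F-d): the measure of a compact cut of a centrally saturated
subgroup, above and below, in any group with a left-invariant measure

Blind re-derivation cell `pub-hodge-repro`, Tier 4 «prove the step» (README §9–§10), seat t4-L1-p4 (gen 5; LINE L4;
STATUS S15641 (3) (F-c)/(F-d), after t4-L2-p3's finding F-L4-PROJ-NONUNIFORM (S15509) moved the display (F) to the COMPACT
cut and crit-2 g9's Entry 314 (S15609) asked for the FOLD step).  Tree path
`lean/Summits/Ventures/HodgeRepro/Tier4/Line4/CentralCover.lean`.  Mathlib only; no cell definition is used — the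
statements are about an arbitrary group `G` with a left-invariant measure `ν`, a CENTRAL subgroup `Z` (the finite centre
`Z_f`, or its `p`-part `Z_p`), two nested subgroups `B ≤ B₀` (the level boxes `T_p ∩ K_p(p^n) ≤ T_p ∩ K_p(p^{n₀})`) and a
set `C` (the compact cut `π_f(closure D_T)`), the covering numbers entering as finite sets of translates, exactly as
compactness produces them.  No literature; no `def`.

WHAT IT IS FOR.  After (F-a)+(F-b) (CompactCutFold) the display (F) needs the PROJECTION bound on the compact cut,
uniform in `γ`: `ν_f(C ∩ projSet γ)` where, by P2 (the `p`-adic congruence at `γ₀`, L2-p3), the `p`-part of `projSet γ`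
lies in `Z_p · B` with `B = T_p ∩ K_p(p^{n−c₀})`.  The honest content of «P4» is then not a measurable section of
`T_p → T_p / Z_p` but the two elementary bounds below:
* **`measure_inter_mul_le_card_mul_card_mul` (F-c, UPPER)** — if `C ⊆ ⋃_{i ∈ I} i • B₀` and `Z ∩ B₀ ⊆ ⋃_{j ∈ J} j • B`
  then `ν(C ∩ Z·B) ≤ |I| · |J| · ν(B)`.  Proof: on a coset `i B₀` meeting `Z·B` at `y = z b`, every `x = z′ b′` of
  `i B₀ ∩ Z·B` has `z⁻¹ z′ = (y⁻¹ x)(b′⁻¹ b) ∈ Z ∩ B₀` (`z` central), so `x ∈ (z j) • B` for some `j ∈ J`: the cut of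
  the coset is covered by `|J|` translates of `B`, each of measure `ν(B)`.
* **`card_mul_measure_le_measure_of_pairwiseDisjoint` (F-d, LOWER)** — `|J| · ν(B) ≤ ν(D)` when the translates `j • B`,
  `j ∈ J`, are pairwise disjoint and lie in `D`; with `disjoint_smul_of_inv_mul_notMem` (`j⁻¹ j′ ∉ B ⇒ j • B ∩ j′ • B = ∅`
  for a subgroup `B`) this is the unit's lower bound `ν_f(DZ_f ∩ Z_f · B_n) ≥ [Z_f ∩ B_{n₀} : Z_f ∩ B_n] · ν_f(B_n)` once
  representatives `J ⊆ Z_f ∩ B_{n₀}` of `(Z_f ∩ B_{n₀}) / (Z_f ∩ B_n)` are chosen with `B_{n₀} ⊆ DZ_f` (ZDOMAIN-EX's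
  neighbourhood of `1`).
The exponent bookkeeping of (F) (S15641 (3)): upper and lower bounds both carry the index `[Z ∩ B₀ : Z ∩ B_n]` times
`ν(B_n)`, so the ratio is bounded by the covering numbers of the compact cut and the bounded index ratios of P3.

Nothing here says anything about the status of the Hodge conjecture for CM abelian varieties, which is NOT proved
(HC_CM is NOT proved by anyone in this repository).
-/

set_option autoImplicit false
noncomputable section
namespace Summit.Ventures.HodgeRepro.Tier4.Line4
open MeasureTheory
open scoped ENNReal Pointwise

section CentralCover
variable {G : Type*} [Group G] [MeasurableSpace G] [MeasurableMul G] (ν : Measure G) [ν.IsMulLeftInvariant]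

/-- A left translate of a set has the same measure (left invariance, in the `•` form). -/
theorem measure_smul_set_eq (g : G) (s : Set G) : ν (g • s) = ν s := by
  have h : g • s = (fun x : G => g⁻¹ * x) ⁻¹' s := by
    ext x
    constructor
    · rintro ⟨y, hy, rfl⟩
      simpa [Set.mem_preimage] using hy
    · intro hx
      exact ⟨g⁻¹ * x, hx, by simp⟩
  rw [h]
  exact measure_preimage_mul ν g⁻¹ s

omit [MeasurableSpace G] [MeasurableMul G] in
/-- **The cut of one coset of `B₀` by `Z · B` is covered by `|J|` translates of `B`**: with `Z` central, `B ≤ B₀`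
subgroups and `Z ∩ B₀ ⊆ ⋃_{j ∈ J} j • B`, for every `g` there is `z` with `g • B₀ ∩ Z·B ⊆ ⋃_{j ∈ J} (z * j) • B`. -/
theorem coset_inter_mul_subset_iUnion (Z : Subgroup G) (hZ : ∀ z ∈ Z, ∀ g : G, z * g = g * z)
    (B₀ B : Subgroup G) (hBB₀ : B ≤ B₀) (J : Finset G)
    (hJ : (Z : Set G) ∩ (B₀ : Set G) ⊆ ⋃ j ∈ J, j • (B : Set G)) (g : G) :
    ∃ z : G, g • (B₀ : Set G) ∩ ((Z : Set G) * (B : Set G)) ⊆ ⋃ j ∈ J, (z * j) • (B : Set G) := by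
  by_cases hne : (g • (B₀ : Set G) ∩ ((Z : Set G) * (B : Set G))).Nonempty
  · obtain ⟨y, hyB₀, hyZB⟩ := hne
    obtain ⟨z, hz, b, hb, rfl⟩ := Set.mem_mul.1 hyZB
    refine ⟨z, ?_⟩
    rintro x ⟨hxB₀, hxZB⟩
    obtain ⟨z', hz', b', hb', rfl⟩ := Set.mem_mul.1 hxZB
    -- `(z b)⁻¹ (z' b') ∈ B₀` since both lie in the coset `g • B₀`
    have hcoset : (z * b)⁻¹ * (z' * b') ∈ B₀ := by
      obtain ⟨u, hu, hu'⟩ := hyB₀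
      obtain ⟨v, hv, hv'⟩ := hxB₀
      simp only [smul_eq_mul] at hu' hv'
      have : (z * b)⁻¹ * (z' * b') = u⁻¹ * v := by
        rw [← hu', ← hv']
        group
      rw [this]
      exact B₀.mul_mem (B₀.inv_mem hu) hv
    -- `z⁻¹ z'` is central
    have hcc : ∀ g : G, Commute (z⁻¹ * z') g := fun g =>
      Commute.mul_left (Commute.inv_left (show Commute z g from hZ z hz g)) (show Commute z' g from hZ z' hz' g)
    -- hence `z⁻¹ z' ∈ Z ∩ B₀`
    have hzz' : z⁻¹ * z' ∈ (Z : Set G) ∩ (B₀ : Set G) := by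
      refine ⟨Z.mul_mem (Z.inv_mem hz) hz', ?_⟩
      have h1 : (z * b)⁻¹ * (z' * b') = (z⁻¹ * z') * (b⁻¹ * b') := by
        calc (z * b)⁻¹ * (z' * b') = b⁻¹ * (z⁻¹ * z') * b' := by group
          _ = (z⁻¹ * z') * b⁻¹ * b' := by rw [← (hcc b⁻¹).eq]
          _ = (z⁻¹ * z') * (b⁻¹ * b') := by group
      have h2 : z⁻¹ * z' = ((z * b)⁻¹ * (z' * b')) * (b'⁻¹ * b) := by
        rw [h1]
        group
      rw [h2]
      exact B₀.mul_mem hcoset (hBB₀ (B.mul_mem (B.inv_mem hb') hb))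
    obtain ⟨j, hj, hmem⟩ := Set.mem_iUnion₂.1 (hJ hzz')
    obtain ⟨b'', hb'', hb''eq⟩ := hmem
    simp only [smul_eq_mul] at hb''eq
    refine Set.mem_iUnion₂.2 ⟨j, hj, b'' * b', B.mul_mem hb'' hb', ?_⟩
    -- `z' b' = z (z⁻¹ z') b' = z j b'' b'`
    show z * j * (b'' * b') = z' * b'
    calc z * j * (b'' * b') = z * (j * b'') * b' := by group
      _ = z * (z⁻¹ * z') * b' := by rw [hb''eq]
      _ = z' * b' := by group
  · refine ⟨1, ?_⟩
    rw [Set.not_nonempty_iff_eq_empty.1 hne]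
    exact Set.empty_subset _

/-- **(F-c) THE UPPER BOUND**: `ν(C ∩ Z·B) ≤ |I| · |J| · ν(B)` when `C ⊆ ⋃_{i ∈ I} i • B₀` (the covering number of `C`
by cosets of the larger box `B₀`) and `Z ∩ B₀ ⊆ ⋃_{j ∈ J} j • B` (the index-type cover of `Z ∩ B₀` by translates of
`B`); `Z` central, `B ≤ B₀` subgroups.  No measurability is needed (outer measure on the left). -/
theorem measure_inter_mul_le_card_mul_card_mul (Z : Subgroup G) (hZ : ∀ z ∈ Z, ∀ g : G, z * g = g * z)
    (B₀ B : Subgroup G) (hBB₀ : B ≤ B₀) (C : Set G) (I : Finset G) (hC : C ⊆ ⋃ i ∈ I, i • (B₀ : Set G))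
    (J : Finset G) (hJ : (Z : Set G) ∩ (B₀ : Set G) ⊆ ⋃ j ∈ J, j • (B : Set G)) :
    ν (C ∩ ((Z : Set G) * (B : Set G))) ≤ I.card * J.card * ν (B : Set G) := by
  -- choose the centring element of each coset
  choose z hz using coset_inter_mul_subset_iUnion Z hZ B₀ B hBB₀ J hJ
  calc ν (C ∩ ((Z : Set G) * (B : Set G)))
      ≤ ν (⋃ i ∈ I, (i • (B₀ : Set G) ∩ ((Z : Set G) * (B : Set G)))) := by
        apply measure_mono
        rintro x ⟨hxC, hxZB⟩
        obtain ⟨i, hi, hxi⟩ := Set.mem_iUnion₂.1 (hC hxC)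
        exact Set.mem_iUnion₂.2 ⟨i, hi, hxi, hxZB⟩
    _ ≤ ∑ i ∈ I, ν (i • (B₀ : Set G) ∩ ((Z : Set G) * (B : Set G))) := measure_biUnion_finset_le I _
    _ ≤ ∑ _i ∈ I, (J.card * ν (B : Set G)) := by
        refine Finset.sum_le_sum fun i _ => ?_
        calc ν (i • (B₀ : Set G) ∩ ((Z : Set G) * (B : Set G)))
            ≤ ν (⋃ j ∈ J, (z i * j) • (B : Set G)) := measure_mono (hz i)
          _ ≤ ∑ j ∈ J, ν ((z i * j) • (B : Set G)) := measure_biUnion_finset_le J _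
          _ = ∑ _j ∈ J, ν (B : Set G) := Finset.sum_congr rfl fun j _ => measure_smul_set_eq ν _ _
          _ = J.card * ν (B : Set G) := by rw [Finset.sum_const, nsmul_eq_mul]
    _ = I.card * J.card * ν (B : Set G) := by rw [Finset.sum_const, nsmul_eq_mul, mul_assoc]

omit [MeasurableSpace G] [MeasurableMul G] in
/-- Two translates of a subgroup by `j`, `j′` with `j⁻¹ j′ ∉ B` are disjoint. -/
theorem disjoint_smul_of_inv_mul_notMem (B : Subgroup G) {j j' : G} (h : j⁻¹ * j' ∉ B) :
    Disjoint (j • (B : Set G)) (j' • (B : Set G)) := by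
  rw [Set.disjoint_left]
  rintro x ⟨b, hb, rfl⟩ ⟨b', hb', hb'eq⟩
  apply h
  simp only [smul_eq_mul] at hb'eq
  have : j⁻¹ * j' = b * b'⁻¹ := by
    calc j⁻¹ * j' = j⁻¹ * (j' * b') * b'⁻¹ := by group
      _ = j⁻¹ * (j * b) * b'⁻¹ := by rw [hb'eq]
      _ = b * b'⁻¹ := by group
  rw [this]
  exact B.mul_mem hb (B.inv_mem hb')

/-- **(F-d) THE LOWER BOUND**: `|J| · ν(B) ≤ ν(D)` when the translates `j • B`, `j ∈ J`, are pairwise disjoint,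
measurable, and contained in `D`. -/
theorem card_mul_measure_le_measure_of_pairwiseDisjoint {B : Set G} (hB : MeasurableSet B) (D : Set G) (J : Finset G)
    (hJD : ∀ j ∈ J, j • B ⊆ D) (hdisj : (J : Set G).PairwiseDisjoint (fun j => j • B)) :
    J.card * ν B ≤ ν D := by
  haveI : MeasurableConstSMul G G := ⟨fun c => measurable_const_mul c⟩
  have hmeas : ∀ j ∈ J, MeasurableSet (j • B) := fun j _ => hB.const_smul j
  calc (J.card : ℝ≥0∞) * ν B = ∑ _j ∈ J, ν B := by rw [Finset.sum_const, nsmul_eq_mul]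
    _ = ∑ j ∈ J, ν (j • B) := Finset.sum_congr rfl fun j _ => (measure_smul_set_eq ν j B).symm
    _ = ν (⋃ j ∈ J, j • B) := (measure_biUnion_finset hdisj hmeas).symm
    _ ≤ ν D := measure_mono (Set.iUnion₂_subset hJD)

/-- **(F-d) for a subgroup `B` and representatives `J` of distinct cosets**: if `j⁻¹ j′ ∉ B` for `j ≠ j′` in `J` and every
`j • B ⊆ D`, then `|J| · ν(B) ≤ ν(D)`. -/
theorem card_mul_measure_le_measure_of_reps (B : Subgroup G) (hB : MeasurableSet (B : Set G)) (D : Set G)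
    (J : Finset G) (hJD : ∀ j ∈ J, j • (B : Set G) ⊆ D) (hreps : ∀ j ∈ J, ∀ j' ∈ J, j ≠ j' → j⁻¹ * j' ∉ B) :
    J.card * ν (B : Set G) ≤ ν D :=
  card_mul_measure_le_measure_of_pairwiseDisjoint ν hB D J hJD fun j hj j' hj' hne =>
    disjoint_smul_of_inv_mul_notMem B (hreps j hj j' hj' hne)

end CentralCover

end Summit.Ventures.HodgeRepro.Tier4.Line4

end
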